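import Summits.NavierStokesRegularity.FluidComputer.PalasekTowerBurgersCorner
import Summits.NavierStokesRegularity.FluidComputer.PalasekTowerBurgersVortexCircle

/-!
# The Burgers child core at a re-tuned register, II: the CORE-LEDGER clause on the rim circle — all FOUR level-1 clauses
# at the corner `(2^23, 41/40, 12/5)` with natural endowment, and the rim circle's shortfall on the wide rates
# (crux `EpisodeBase`, stmt-NavierStokesRegularity-19179; kernel companion III of RE-TUNING BRIEF v1.2c §9)

Cell `ns-blowup`, seat `ns-palasek-19179-p2` (g5). Sequel of `PalasekTowerBurgersCorner.lean` (p513535: speed floor, soft ceiling,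
strain floor of the MODEL child core `burgersVortex (λA₀) 1 (C·N₁^{β−2})` at `(C, λ) = (3/2, 1)`) using the circulation identity of
`PalasekTowerBurgersVortexCircle.lean` (`∮_{circle ρ} = Γ(1 − e^{−γρ²/4ν})`): on the RIM CIRCLE of the level-`1` core ball (radius
`1/N₁` about the axis, once around, speed `2π/N₁ ≤ 8π/N₁`) the child core carries circulation `C·N₁^{β−2}·(1 − e^{−λN₀^{β−2b}/4})`
(§1, any rates: `A₀/N₁² = N₀^{β−2b}` is the DC1 margin = the squared Burgers factor). Hence

* §2 (ANY rates): if `N₀^{β−2b} ≥ 8` the `(3/2, 1)` child core meets the level-`1` CORE-LEDGER clause of the register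
  (`c₁ = 1`: some `C¹` closed loop inside `closedBall 0 (1/N₁)` of speed `≤ 8π/N₁` with circulation `≥ N₁^{β−2}`) — on the rim
  circle itself (`1 − e^{−2} ≥ 2/3`);
* §3 (the corner `(2^23, 41/40, 12/5)`, `N₀^{β−2b} > 264`): ALL FOUR level-`1` clauses — speed floor, soft ceiling `(3/2)Y₁`, strain
  floor, core ledger — hold for the `(3/2, 1)` child core (`palasekTowerBreakdown_burgersCorner_passes_all`);
* §4 (the item of record): on the wide rates `N₀^{β−2b} = 256^{1/10} < 1.7412`, and the rim circle of the SAME `(3/2, 1)` core carries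
  `< (3/2)·(1.7412/4)·N₁^{β−2} < 0.66·N₁^{β−2}` — short of the floor (the core is wider than the ball; p513535's speed-floor miss is
  the companion statement).

LABEL: E–C / MODEL register arithmetic (KERNEL). WHAT THIS IS NOT: not Navier–Stokes evidence — an exact infinite-energy profile read
against the register's letter; no registered stage, nothing about `EpisodeBase` or any re-tuned item (D-0014).

References: P. G. Saffman, *Vortex Dynamics* (CUP 1992) §13.1 (3) [cite: Saffman1992, §13.1 eq. (3)]; S. Palasek, arXiv:2605.13827
§3 (3.2) [cite: Palasek2026ElementaryModel, §3 (3.2)].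
-/

noncomputable section

namespace Summit.NavierStokesRegularity.FluidComputer.PalasekTowerClayBridge

open Real Set Metric
open Literature.Analysis.FluidPDE

/-! ## §1 The rim circle of the level-1 core ball and the child core's circulation on it (any rates) -/

namespace TowerRates

variable (R : TowerRates)

/-- `A₀/N₁² = N₀^{β−2b}` (the DC1 margin; `= B²`). [cite: Palasek2026ElementaryModel, §3 (3.2)] -/
theorem A_zero_div_N_one_sq : R.A 0 / R.N 1 ^ 2 = R.N 0 ^ (R.β - 2 * R.b) := by
  have h2 : R.N 1 ^ 2 = R.N₀ ^ (2 * R.b) := by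
    rw [R.N_one_eq, ← Real.rpow_natCast, ← Real.rpow_mul R.N₀_pos.le]
    congr 1; push_cast; ring
  have hA : R.A 0 = R.N₀ ^ R.β := by simp only [TowerRates.A]; rw [R.N_zero_eq_N₀]
  rw [h2, hA, R.N_zero_eq_N₀, ← Real.rpow_sub R.N₀_pos]

end TowerRates

/-- The rim circle of the level-`1` core ball: radius `1/N₁` about the axis in the horizontal plane. [folklore] -/
theorem rimCircle_mem_closedBall (R : TowerRates) (s : ℝ) :
    circleLoop (0 : EuclideanSpace ℝ (Fin 3)) (1 / R.N 1) (EuclideanSpace.single (0 : Fin 3) (1 : ℝ))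
        (EuclideanSpace.single (1 : Fin 3) (1 : ℝ)) s ∈
      closedBall (0 : EuclideanSpace ℝ (Fin 3)) (1 / R.N 1) := by
  rw [mem_closedBall, dist_zero_right, norm_circleLoop_axis, abs_of_pos (by have := R.N_pos 1; positivity)]

/-- The rim circle's speed is `2π/N₁ ≤ 8π/N₁`. [folklore] -/
theorem norm_deriv_rimCircle_le (R : TowerRates) (s : ℝ) :
    ‖deriv (circleLoop (0 : EuclideanSpace ℝ (Fin 3)) (1 / R.N 1) (EuclideanSpace.single (0 : Fin 3) (1 : ℝ))
        (EuclideanSpace.single (1 : Fin 3) (1 : ℝ))) s‖ ≤ 8 * π / R.N 1 := by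
  rw [norm_deriv_circleLoop_axis, abs_of_pos (by have := R.N_pos 1; positivity)]
  have := R.N_pos 1
  have hπ := Real.pi_pos
  rw [le_div_iff₀ this]
  field_simp
  nlinarith

/-- **The child core's circulation on the rim circle** (any rates, `λ > 0`, any `C`):
`∮ = C·N₁^{β−2}·(1 − e^{−λN₀^{β−2b}/4})`. [cite: Saffman1992, §13.1 eq. (3)] -/
theorem circulation_burgersChild_rimCircle (R : TowerRates) {l : ℝ} (hl : 0 < l) (C : ℝ) :
    circulation (burgersVortex (l * R.A 0) 1 (C * R.N (0 + 1) ^ (R.β - 2)))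
        (circleLoop (0 : EuclideanSpace ℝ (Fin 3)) (1 / R.N 1) (EuclideanSpace.single (0 : Fin 3) (1 : ℝ))
          (EuclideanSpace.single (1 : Fin 3) (1 : ℝ))) =
      C * R.N 1 ^ (R.β - 2) * (1 - Real.exp (-(l * R.N 0 ^ (R.β - 2 * R.b) / 4))) := by
  have hγ : l * R.A 0 ≠ 0 := (mul_pos hl (R.A_pos 0)).ne'
  rw [circulation_burgersVortex_circleLoop hγ one_ne_zero, show (0 + 1 : ℕ) = 1 from rfl]
  congr 3
  rw [← R.A_zero_div_N_one_sq]
  have hN := (R.N_pos 1).ne'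
  field_simp

/-! ## §2 The core-ledger clause at natural endowment (any rates with `N₀^{β−2b} ≥ 8`) -/

/-- **CORE LEDGER at natural endowment**: for any rates with `N₀^{β−2b} ≥ 8`, the Burgers child core of circulation `(3/2)·N₁^{β−2}`
in the level-`0` strain floor (`λ = 1`, `ν = 1`) meets the level-`1` core-ledger clause of the register with `c₁ = 1` — on the rim
circle of the core ball: a `C¹` closed loop inside `closedBall 0 (1/N₁)`, speed `≤ 8π/N₁`, circulation `≥ N₁^{β−2}`
(`(3/2)(1 − e^{−2}) ≥ (3/2)(2/3) = 1`). [cite: Saffman1992, §13.1 eq. (3)] -/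
theorem palasekTowerBreakdown_burgersCorner_coreLedger (R : TowerRates) (hB2 : (8 : ℝ) ≤ R.N 0 ^ (R.β - 2 * R.b)) :
    ∃ (x' : EuclideanSpace ℝ (Fin 3)) (γ : ℝ → EuclideanSpace ℝ (Fin 3)),
      ‖x'‖ ≤ 0 ∧ ContDiff ℝ 1 γ ∧ γ 0 = γ 1 ∧
      (∀ s ∈ Icc (0 : ℝ) 1, γ s ∈ closedBall x' (1 / R.N 1)) ∧
      (∀ s ∈ Icc (0 : ℝ) 1, ‖deriv γ s‖ ≤ 8 * π / R.N 1) ∧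
      1 * R.N 1 ^ (R.β - 2) ≤ circulation (burgersVortex (1 * R.A 0) 1 (3 / 2 * R.N (0 + 1) ^ (R.β - 2))) γ := by
  refine ⟨0, circleLoop (0 : EuclideanSpace ℝ (Fin 3)) (1 / R.N 1) (EuclideanSpace.single (0 : Fin 3) (1 : ℝ))
      (EuclideanSpace.single (1 : Fin 3) (1 : ℝ)), by simp, contDiff_circleLoop _ _ _ _, ?_,
    fun s _ => rimCircle_mem_closedBall R s, fun s _ => norm_deriv_rimCircle_le R s, ?_⟩
  · have h := periodic_circleLoop (0 : EuclideanSpace ℝ (Fin 3)) (1 / R.N 1) (EuclideanSpace.single (0 : Fin 3) (1 : ℝ))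
      (EuclideanSpace.single (1 : Fin 3) (1 : ℝ)) 0
    rw [zero_add] at h
    exact h.symm
  · rw [circulation_burgersChild_rimCircle R one_pos]
    have hN : 0 < R.N 1 ^ (R.β - 2) := Real.rpow_pos_of_pos (R.N_pos 1) _
    have hx : (2 : ℝ) ≤ 1 * R.N 0 ^ (R.β - 2 * R.b) / 4 := by linarith
    have hexp_aux : ∀ {x : ℝ}, 0 ≤ x → Real.exp (-x) ≤ 1 / (1 + x) := fun {x} hx0 => by
      have h := Real.add_one_le_exp x
      rw [Real.exp_neg, le_div_iff₀ (by linarith), inv_mul_le_iff₀ (Real.exp_pos x)]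
      linarith
    have hexp : Real.exp (-(1 * R.N 0 ^ (R.β - 2 * R.b) / 4)) ≤ 1 / 3 := by
      calc Real.exp (-(1 * R.N 0 ^ (R.β - 2 * R.b) / 4))
          ≤ 1 / (1 + 1 * R.N 0 ^ (R.β - 2 * R.b) / 4) := hexp_aux (by linarith)
        _ ≤ 1 / 3 := by
          apply div_le_div_of_nonneg_left zero_le_one (by norm_num)
          linarith
    nlinarith

/-! ## §3 The corner `(2^23, 41/40, 12/5)`: all four level-1 clauses -/

/-- **THE CORNER PASSES ALL FOUR level-1 clauses at `(C, λ) = (3/2, 1)`** — speed floor `Y₁` somewhere, soft ceiling `(3/2)·Y₁`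
everywhere, strain floor `A₁` on the axis, and the core-ledger clause on the rim circle — for every rates record with
`(N₀, b, β) = (2^23, 41/40, 12/5)` (`N₀^{β−2b} > 264 ≥ 8`). [cite: Saffman1992, §13.1 eq. (3)] -/
theorem palasekTowerBreakdown_burgersCorner_passes_all (R : TowerRates) (hN : R.N₀ = 2 ^ 23) (hb : R.b = 41 / 40)
    (hβ : R.β = 12 / 5) :
    (∃ x : EuclideanSpace ℝ (Fin 3),
      1 * R.Y (0 + 1) ≤ ‖burgersVortexSwirl (1 * R.A 0) 1 (3 / 2 * R.N (0 + 1) ^ (R.β - 2)) x‖) ∧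
    (∀ x : EuclideanSpace ℝ (Fin 3),
      ‖burgersVortexSwirl (1 * R.A 0) 1 (3 / 2 * R.N (0 + 1) ^ (R.β - 2)) x‖ ≤ 3 / 2 * R.Y (0 + 1)) ∧
    (∃ x : EuclideanSpace ℝ (Fin 3),
      1 * R.A (0 + 1) ≤ ‖fderiv ℝ (burgersVortex (1 * R.A 0) 1 (3 / 2 * R.N (0 + 1) ^ (R.β - 2))) x‖) ∧
    (∃ (x' : EuclideanSpace ℝ (Fin 3)) (γ : ℝ → EuclideanSpace ℝ (Fin 3)),
      ‖x'‖ ≤ 0 ∧ ContDiff ℝ 1 γ ∧ γ 0 = γ 1 ∧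
      (∀ s ∈ Icc (0 : ℝ) 1, γ s ∈ closedBall x' (1 / R.N 1)) ∧
      (∀ s ∈ Icc (0 : ℝ) 1, ‖deriv γ s‖ ≤ 8 * π / R.N 1) ∧
      1 * R.N 1 ^ (R.β - 2) ≤ circulation (burgersVortex (1 * R.A 0) 1 (3 / 2 * R.N (0 + 1) ^ (R.β - 2))) γ) := by
  obtain ⟨h1, h2, h3⟩ := palasekTowerBreakdown_burgersCorner_passes R hN hb hβ
  have hsq := palasekTowerBreakdown_burgersCorner_factor_sq_gt R hN hb hβ
  exact ⟨h1, h2, h3, palasekTowerBreakdown_burgersCorner_coreLedger R (by linarith)⟩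

/-! ## §4 The item of record: the rim circle's shortfall on the wide rates -/

/-- On the wide rates the DC1 margin is `N₀^{β−2b} = 256^{1/10} < 1.7412` (p511376 `rpow_256_tenth_bounds`). [folklore] -/
theorem palasekTowerBreakdown_burgersWide_dc1Margin_lt :
    TowerRates.wide.N 0 ^ (TowerRates.wide.β - 2 * TowerRates.wide.b) < 1.7412 := by
  have h : TowerRates.wide.N 0 ^ (TowerRates.wide.β - 2 * TowerRates.wide.b) = (256 : ℝ) ^ ((1 : ℝ) / 10) := by
    rw [TowerRates.wide_N_zero]; simp only [TowerRates.wide]; norm_num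
  rw [h]
  exact UniversalFace.rpow_256_tenth_bounds.2

/-- **ON THE WIDE RATES THE RIM CIRCLE FALLS SHORT**: the same `(3/2, 1)` child core carries on the rim circle of the level-`1` core
ball only `(3/2)(1 − e^{−N₀^{β−2b}/4})·N₁^{β−2} < 0.66·N₁^{β−2}` — below the floor `N₁^{β−2}` (its Gaussian core, of radius
`2A₀^{−1/2}`, is wider than the ball: `4N₁²/A₀ = 4/N₀^{β−2b} > 2.29`). [cite: Saffman1992, §13.1 eq. (3)] -/
theorem palasekTowerBreakdown_burgersWide_rimCircle_short :
    circulation (burgersVortex (1 * TowerRates.wide.A 0) 1 (3 / 2 * TowerRates.wide.N (0 + 1) ^ (TowerRates.wide.β - 2)))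
        (circleLoop (0 : EuclideanSpace ℝ (Fin 3)) (1 / TowerRates.wide.N 1) (EuclideanSpace.single (0 : Fin 3) (1 : ℝ))
          (EuclideanSpace.single (1 : Fin 3) (1 : ℝ))) <
      0.66 * TowerRates.wide.N 1 ^ (TowerRates.wide.β - 2) := by
  rw [circulation_burgersChild_rimCircle TowerRates.wide one_pos]
  have hN : 0 < TowerRates.wide.N 1 ^ (TowerRates.wide.β - 2) := Real.rpow_pos_of_pos (TowerRates.wide.N_pos 1) _
  have hm := palasekTowerBreakdown_burgersWide_dc1Margin_lt
  have h1 : 1 - Real.exp (-(1 * TowerRates.wide.N 0 ^ (TowerRates.wide.β - 2 * TowerRates.wide.b) / 4)) ≤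
      1 * TowerRates.wide.N 0 ^ (TowerRates.wide.β - 2 * TowerRates.wide.b) / 4 := by
    have := Real.add_one_le_exp (-(1 * TowerRates.wide.N 0 ^ (TowerRates.wide.β - 2 * TowerRates.wide.b) / 4))
    linarith
  have h2 : 1 - Real.exp (-(1 * TowerRates.wide.N 0 ^ (TowerRates.wide.β - 2 * TowerRates.wide.b) / 4)) < 0.44 := by
    linarith
  nlinarith

end Summit.NavierStokesRegularity.FluidComputer.PalasekTowerClayBridge

end
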